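import Summits.CriticalPhenomena.PercolationContinuityZ3.Theorems.PercNearOneGluingNoHeavyQuantSubproductMixture
import HarnessLib

/-!
# QUANT lane R8, T-DEC: THE MEAN-LINE TRANSFER CERTIFICATE — width 3, arbitrary gates / means / sub-trees: drop one sibling, OPEN a second one
# fully and LOWER the third to the mean line; a 3-node transport with explicit capacities makes the triple SDEC at the TRUE floor, GIVEN the oracle —
# the family that takes over exactly where boosting becomes floor-illegal (two largest gates summing to more than `1`)

builds on p205010 (kernel theorem, internal audit signed; external expert review pending)

Support file (`--supports stmt-CriticalPhenomena-4575`), QUANT lane seat prim-quant-census-1 (gen 27), rung R8 of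
`run/shared/lean/prim/quant/LADDER.md`; memo `run/shared/lean/prim/quant/prim-quant-census-1/g27/PAIRFLOW-G27.md` §7.  Theorems only, standard axioms,
no sorries.  An INSTANCE of ✓ `…QuantSubproductMixture` (`sdec_flaw_of_subproductMix`, p503068), complementary to the boosted dictionary
(✓ `…QuantCyclicBoostGeneral` p510431, ✓ `…QuantPairFlowCertificate` p513450).

THE COLUMNS (memo §7; found from the exact LP map of width 3).  Siblings `a, b, d` with gates `q`, opened means `m`, `fm = Σ qᵢmᵢ`.  The MEAN-LINE column
`(d; a, b)`: DROP `d`, OPEN `a` fully, and put `b` at the openness `t_{ab} = (fm − m_a)/m_b ∈ (0,1]` — the point of the mean line `o_a m_a + o_b m_b = fm` with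
`o_a = 1` (legal: `d` dropped; mean exactly `fm`).  It charges only the patterns `{a}` (mass `1 − t_{ab}`) and `{a,b}` (mass `t_{ab}`).  Hence a nonnegative
TRANSPORT `x_{a→b}` (weight of `(d; a, b)`) is a sub-product certificate iff
    (node a)   `(1 − t_{ab})·x_{a→b} + (1 − t_{ad})·x_{a→d} = q_a (1−q_b)(1−q_d)`      (the singleton patterns),
    (edge ab)  `t_{ab}·x_{a→b} + t_{ba}·x_{b→a} ≤ q_a q_b (1−q_d)`                         (open pairs absorb the rest),
a 3-node / 3-edge transportation problem; with equal means (`t ≡ Q − 1`, `Q = Σq ∈ (1,2)`) it is feasible iff the Hall conditions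
`t(1−q_b)(1−q_d) ≤ (2−Q)(q_b(1−q_d) + q_d(1−q_b))` (each `a`) and `t·Σ_a q_a(1−q_b)(1−q_d) ≤ (2−Q)·Σ_{a<b} q_a q_b(1−q_d)` hold (exact LP == Hall on all 1330 grid
triples, `k3_meanline.py`).  FLOORS: the lowered openness must carry the forest floor, `x ≤ t_{ab}·x₁_b`, i.e. `x·m_b ≤ (fm − m_a)·x₁_b` — with equal means and
floors this is `Q − 1 ≥ min q`, the COMPLEMENT of the boosted region (two largest gates `≥ 1`).  CENSUS (width 3, equal means, gates on the 1/20 grid, 1330 sorted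
triples): cyclic/boosted 385, mean-line 340, heavy-balanced U-RPM (p496166) 615, union 842; the full closed-form dictionary (boosts + mean-line + 'open c' +
singletons + open sets) certifies nothing outside this union; the grid-10 LP of the criterion 758 (36 of them outside the union: two-open/raised columns).

* **`sdec_flaw_meanLine_of_transport`**: `0 < x < 1`; `s₀ s₁ s₂` tree-built at `x`; pair means `≥ fm` and `fm > mᵢ` (so every `t ∈ (0,1]`); the six floor
  conditions `x·m_b ≤ (fm − m_a)·s_b.x₁` and `x·Σm ≤ fm·sᵢ.x₁`; a nonnegative transport `x₀₁ x₀₂ x₁₀ x₁₂ x₂₀ x₂₁` with the three node equations and the three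
  edge inequalities (all with `t_{ab}·m_b = fm − m_a` multiplied out); the oracle below `fgates [s₀,s₁,s₂]` ⟹ `SDEC x (ftop [s₀,s₁,s₂]) (flaw [s₀,s₁,s₂])`.

HONEST STATUS.  A width-3 sub-family of the open core; `SiblingStep` ⟺ `GateStepN`, `UPartStep`, `LightResidDECOracle`, `FarTreeRow` remain OPEN; RATE class
(log\*) and the honest sentence of `run/shared/lean/prim/quant/README.md` unchanged.  [this work]; nothing here is cited as a published result.  The gluing
rows served [cite: KozmaNitzan2024, Conjecture 3 (p. 15)]; product measure [cite: Grimmett1999, §1.3 p. 10].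
-/

noncomputable section

open scoped BigOperators

namespace Summit.CriticalPhenomena.PercolationContinuityZ3.Theorems
namespace Quant
namespace LawDec

open Finset

/-- **the pattern bookkeeping of the mean-line certificate** (pure algebra): with openings `T c` of the lowered sibling in the six mean-line columns
`(0;1) (0;2) (1;0) (1;2) (2;0) (2;1)` (first index = the opened sibling), weights `X`, open-pair weights defined as the slacks and the open triple `abc`,
the sub-product sum on every non-empty pattern equals the root-pattern law as soon as the three NODE equations hold. [this work] -/
theorem meanLine_pattern (a b c : ℝ) (T X : Fin 6 → ℝ)
    (hn0 : (1 - T 0) * X 0 + (1 - T 1) * X 1 = a * (1 - b) * (1 - c))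
    (hn1 : (1 - T 2) * X 2 + (1 - T 3) * X 3 = b * (1 - a) * (1 - c))
    (hn2 : (1 - T 4) * X 4 + (1 - T 5) * X 5 = c * (1 - a) * (1 - b))
    (A : Finset (Fin 3)) (hA : A.Nonempty) :
    ∑ k : Fin 10,
      (![X 0, X 1, X 2, X 3, X 4, X 5,
          a * b * (1 - c) - T 0 * X 0 - T 2 * X 2, a * c * (1 - b) - T 1 * X 1 - T 4 * X 4, b * c * (1 - a) - T 3 * X 3 - T 5 * X 5,
          a * b * c] : Fin 10 → ℝ) k *
        (if A ⊆ (![{0, 1}, {0, 2}, {0, 1}, {1, 2}, {0, 2}, {1, 2}, {0, 1}, {0, 2}, {1, 2}, {0, 1, 2}] : Fin 10 → Finset (Fin 3)) k then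
          (∏ i ∈ A, (![fun l => if l = (0 : Fin 3) then 1 else if l = (1 : Fin 3) then T 0 else T 1,
              fun l => if l = (0 : Fin 3) then 1 else if l = (1 : Fin 3) then T 0 else T 1,
              fun l => if l = (1 : Fin 3) then 1 else if l = (0 : Fin 3) then T 2 else T 3,
              fun l => if l = (1 : Fin 3) then 1 else if l = (0 : Fin 3) then T 2 else T 3,
              fun l => if l = (2 : Fin 3) then 1 else if l = (0 : Fin 3) then T 4 else T 5,
              fun l => if l = (2 : Fin 3) then 1 else if l = (0 : Fin 3) then T 4 else T 5,
              fun _ => 1, fun _ => 1, fun _ => 1, fun _ => 1] : Fin 10 → Fin 3 → ℝ) k i) *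
            ∏ i ∈ (![{0, 1}, {0, 2}, {0, 1}, {1, 2}, {0, 2}, {1, 2}, {0, 1}, {0, 2}, {1, 2}, {0, 1, 2}] : Fin 10 → Finset (Fin 3)) k \ A,
              (1 - (![fun l => if l = (0 : Fin 3) then 1 else if l = (1 : Fin 3) then T 0 else T 1,
                fun l => if l = (0 : Fin 3) then 1 else if l = (1 : Fin 3) then T 0 else T 1,
                fun l => if l = (1 : Fin 3) then 1 else if l = (0 : Fin 3) then T 2 else T 3,
                fun l => if l = (1 : Fin 3) then 1 else if l = (0 : Fin 3) then T 2 else T 3,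
                fun l => if l = (2 : Fin 3) then 1 else if l = (0 : Fin 3) then T 4 else T 5,
                fun l => if l = (2 : Fin 3) then 1 else if l = (0 : Fin 3) then T 4 else T 5,
                fun _ => 1, fun _ => 1, fun _ => 1, fun _ => 1] : Fin 10 → Fin 3 → ℝ) k i)
        else 0)
      = (∏ i ∈ A, (![a, b, c] : Fin 3 → ℝ) i) * ∏ i ∈ (Finset.univ : Finset (Fin 3)) \ A, (1 - (![a, b, c] : Fin 3 → ℝ) i) := by
  have hA' : A ≠ ∅ := Finset.nonempty_iff_ne_empty.1 hA
  have key : ∀ B : Finset (Fin 3), B ≠ ∅ →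
      B = {0} ∨ B = {1} ∨ B = {2} ∨ B = {0, 1} ∨ B = {0, 2} ∨ B = {1, 2} ∨ B = {0, 1, 2} := by decide
  have huniv : (Finset.univ : Finset (Fin 3)) = {0, 1, 2} := by decide
  rw [huniv]
  rcases key A hA' with rfl | rfl | rfl | rfl | rfl | rfl | rfl <;>
    simp (config := {decide := true}) [Fin.sum_univ_succ, Finset.sdiff_eq_filter, Finset.filter_insert,
      Finset.filter_singleton, Finset.prod_insert, Finset.prod_singleton] <;> linarith

/-- **THE MEAN-LINE TRANSFER CERTIFICATE (width 3; SDEC form, given the oracle).**  See the module docstring.  Gates `qᵢ`, opened means `mᵢ`,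
`fm = fmean [s₀,s₁,s₂]`; the transport `x_{a→b}` is the weight of the column "drop the third sibling, open `a`, put `b` at `t_{ab} = (fm − m_a)/m_b`";
hypotheses: pair means `≥ fm`, `fm > mᵢ`, the floor conditions, `x ≥ 0`, the node equations `(m_b − (fm − m_a))·x_{a→b}/m_b + … ` written with `t·m_b = fm − m_a`
multiplied out, the edge inequalities; conclusion `SDEC x (ftop [s₀,s₁,s₂]) (flaw [s₀,s₁,s₂])`. [this work] -/
theorem sdec_flaw_meanLine_of_transport {x : ℝ} (hx0 : 0 < x) (hx1 : x < 1) (s₀ s₁ s₂ : Sib)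
    (h₀ : s₀.TreeOK x) (h₁ : s₁.TreeOK x) (h₂ : s₂.TreeOK x)
    -- pair means dominate, no single mean dominates
    (hp01 : fmean [s₀, s₁, s₂] ≤ s₀.mean + s₁.mean) (hp02 : fmean [s₀, s₁, s₂] ≤ s₀.mean + s₂.mean)
    (hp12 : fmean [s₀, s₁, s₂] ≤ s₁.mean + s₂.mean)
    (hm₀ : s₀.mean < fmean [s₀, s₁, s₂]) (hm₁ : s₁.mean < fmean [s₀, s₁, s₂]) (hm₂ : s₂.mean < fmean [s₀, s₁, s₂])
    -- floors: the lowered sibling carries the forest floor, and the open sets do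
    (hf01 : x * s₁.mean ≤ (fmean [s₀, s₁, s₂] - s₀.mean) * s₁.x₁) (hf02 : x * s₂.mean ≤ (fmean [s₀, s₁, s₂] - s₀.mean) * s₂.x₁)
    (hf10 : x * s₀.mean ≤ (fmean [s₀, s₁, s₂] - s₁.mean) * s₀.x₁) (hf12 : x * s₂.mean ≤ (fmean [s₀, s₁, s₂] - s₁.mean) * s₂.x₁)
    (hf20 : x * s₀.mean ≤ (fmean [s₀, s₁, s₂] - s₂.mean) * s₀.x₁) (hf21 : x * s₁.mean ≤ (fmean [s₀, s₁, s₂] - s₂.mean) * s₁.x₁)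
    (hF₀ : x * (s₀.mean + s₁.mean + s₂.mean) ≤ fmean [s₀, s₁, s₂] * s₀.x₁)
    (hF₁ : x * (s₀.mean + s₁.mean + s₂.mean) ≤ fmean [s₀, s₁, s₂] * s₁.x₁)
    (hF₂ : x * (s₀.mean + s₁.mean + s₂.mean) ≤ fmean [s₀, s₁, s₂] * s₂.x₁)
    -- the transport
    (x₀₁ x₀₂ x₁₀ x₁₂ x₂₀ x₂₁ : ℝ) (hx₀₁ : 0 ≤ x₀₁) (hx₀₂ : 0 ≤ x₀₂) (hx₁₀ : 0 ≤ x₁₀) (hx₁₂ : 0 ≤ x₁₂) (hx₂₀ : 0 ≤ x₂₀) (hx₂₁ : 0 ≤ x₂₁)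
    (hN₀ : (s₁.mean - (fmean [s₀, s₁, s₂] - s₀.mean)) * s₂.mean * x₀₁ + (s₂.mean - (fmean [s₀, s₁, s₂] - s₀.mean)) * s₁.mean * x₀₂
      = s₁.mean * s₂.mean * (s₀.q * (1 - s₁.q) * (1 - s₂.q)))
    (hN₁ : (s₀.mean - (fmean [s₀, s₁, s₂] - s₁.mean)) * s₂.mean * x₁₀ + (s₂.mean - (fmean [s₀, s₁, s₂] - s₁.mean)) * s₀.mean * x₁₂
      = s₀.mean * s₂.mean * (s₁.q * (1 - s₀.q) * (1 - s₂.q)))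
    (hN₂ : (s₀.mean - (fmean [s₀, s₁, s₂] - s₂.mean)) * s₁.mean * x₂₀ + (s₁.mean - (fmean [s₀, s₁, s₂] - s₂.mean)) * s₀.mean * x₂₁
      = s₀.mean * s₁.mean * (s₂.q * (1 - s₀.q) * (1 - s₁.q)))
    (hE₀₁ : (fmean [s₀, s₁, s₂] - s₀.mean) * s₀.mean * x₀₁ + (fmean [s₀, s₁, s₂] - s₁.mean) * s₁.mean * x₁₀
      ≤ s₀.mean * s₁.mean * (s₀.q * s₁.q * (1 - s₂.q)))
    (hE₀₂ : (fmean [s₀, s₁, s₂] - s₀.mean) * s₀.mean * x₀₂ + (fmean [s₀, s₁, s₂] - s₂.mean) * s₂.mean * x₂₀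
      ≤ s₀.mean * s₂.mean * (s₀.q * s₂.q * (1 - s₁.q)))
    (hE₁₂ : (fmean [s₀, s₁, s₂] - s₁.mean) * s₁.mean * x₁₂ + (fmean [s₀, s₁, s₂] - s₂.mean) * s₂.mean * x₂₁
      ≤ s₁.mean * s₂.mean * (s₁.q * s₂.q * (1 - s₀.q)))
    (hO : ∀ (x' : ℝ) (n' M' : ℕ) (μ' : ℕ → ℝ), n' < fgates [s₀, s₁, s₂] → TreeBuiltN x' n' M' μ' → SDEC x' M' μ') :
    SDEC x (ftop [s₀, s₁, s₂]) (flaw [s₀, s₁, s₂]) := by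
  classical
  have hmp0 : 0 < s₀.mean := s₀.mean_pos h₀
  have hmp1 : 0 < s₁.mean := s₁.mean_pos h₁
  have hmp2 : 0 < s₂.mean := s₂.mean_pos h₂
  have hL : ∀ t ∈ [s₀, s₁, s₂], t.TreeOK x := by
    intro t ht
    simp only [List.mem_cons, List.not_mem_nil, or_false] at ht
    rcases ht with rfl | rfl | rfl
    · exact h₀
    · exact h₁
    · exact h₂
  obtain ⟨ha0, ha1, hxa, hT₀, _⟩ := h₀
  obtain ⟨hb0, hb1, hxb, hT₁, _⟩ := h₁
  obtain ⟨hc0, hc1, hxc, hT₂, _⟩ := h₂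
  obtain ⟨hy00, hy01, _, _, _, _⟩ := hT₀.lawFacts
  obtain ⟨hy10, hy11, _, _, _, _⟩ := hT₁.lawFacts
  obtain ⟨hy20, hy21, _, _, _, _⟩ := hT₂.lawFacts
  set a : ℝ := s₀.q with hadef
  set b : ℝ := s₁.q with hbdef
  set c : ℝ := s₂.q with hcdef
  set m₀ : ℝ := s₀.mean with hm₀def
  set m₁ : ℝ := s₁.mean with hm₁def
  set m₂ : ℝ := s₂.mean with hm₂def
  set y₀ : ℝ := s₀.x₁ with hy₀def
  set y₁ : ℝ := s₁.x₁ with hy₁def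
  set y₂ : ℝ := s₂.x₁ with hy₂def
  set fm : ℝ := fmean [s₀, s₁, s₂] with hfmdef
  have hfm : fm = a * m₀ + b * m₁ + c * m₂ := by rw [hfmdef]; simp only [fmean]; ring
  have hfm0 : 0 < fm := by rw [hfm]; positivity
  have hmean : ∀ i : Fin [s₀, s₁, s₂].length, ([s₀, s₁, s₂].get i).mean = (![m₀, m₁, m₂] : Fin 3 → ℝ) i := by
    intro i; fin_cases i <;> rfl
  have hfloor : ∀ i : Fin [s₀, s₁, s₂].length, ([s₀, s₁, s₂].get i).x₁ = (![y₀, y₁, y₂] : Fin 3 → ℝ) i := by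
    intro i; fin_cases i <;> rfl
  have hgate : ∀ i : Fin [s₀, s₁, s₂].length, ([s₀, s₁, s₂].get i).q = (![a, b, c] : Fin 3 → ℝ) i := by
    intro i; fin_cases i <;> rfl
  have hm0ne : m₀ ≠ 0 := hmp0.ne'
  have hm1ne : m₁ ≠ 0 := hmp1.ne'
  have hm2ne : m₂ ≠ 0 := hmp2.ne'
  -- the six lowered opennesses
  set T : Fin 6 → ℝ := ![(fm - m₀) / m₁, (fm - m₀) / m₂, (fm - m₁) / m₀, (fm - m₁) / m₂, (fm - m₂) / m₀, (fm - m₂) / m₁] with hTdef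
  have d0 : 0 < fm - m₀ := sub_pos.2 hm₀
  have d1 : 0 < fm - m₁ := sub_pos.2 hm₁
  have d2 : 0 < fm - m₂ := sub_pos.2 hm₂
  have hT0 : ∀ k, 0 < T k := by
    intro k; fin_cases k
    exacts [div_pos d0 hmp1, div_pos d0 hmp2, div_pos d1 hmp0, div_pos d1 hmp2, div_pos d2 hmp0, div_pos d2 hmp1]
  have u01 : (fm - m₀) / m₁ ≤ 1 := (div_le_one hmp1).2 (by linarith only [hp01])
  have u02 : (fm - m₀) / m₂ ≤ 1 := (div_le_one hmp2).2 (by linarith only [hp02])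
  have u10 : (fm - m₁) / m₀ ≤ 1 := (div_le_one hmp0).2 (by linarith only [hp01])
  have u12 : (fm - m₁) / m₂ ≤ 1 := (div_le_one hmp2).2 (by linarith only [hp12])
  have u20 : (fm - m₂) / m₀ ≤ 1 := (div_le_one hmp0).2 (by linarith only [hp02])
  have u21 : (fm - m₂) / m₁ ≤ 1 := (div_le_one hmp1).2 (by linarith only [hp12])
  have hT1 : ∀ k, T k ≤ 1 := by
    intro k; fin_cases k
    exacts [u01, u02, u10, u12, u20, u21]
  set X : Fin 6 → ℝ := ![x₀₁, x₀₂, x₁₀, x₁₂, x₂₀, x₂₁] with hXdef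
  -- node equations and edge inequalities in `T`-form
  have hn0 : (1 - T 0) * X 0 + (1 - T 1) * X 1 = a * (1 - b) * (1 - c) := by
    show (1 - (fm - m₀) / m₁) * x₀₁ + (1 - (fm - m₀) / m₂) * x₀₂ = _
    rw [one_sub_div hm1ne, one_sub_div hm2ne, div_mul_eq_mul_div, div_mul_eq_mul_div, div_add_div _ _ hm1ne hm2ne,
      div_eq_iff (mul_ne_zero hm1ne hm2ne)]
    linear_combination hN₀
  have hn1 : (1 - T 2) * X 2 + (1 - T 3) * X 3 = b * (1 - a) * (1 - c) := by
    show (1 - (fm - m₁) / m₀) * x₁₀ + (1 - (fm - m₁) / m₂) * x₁₂ = _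
    rw [one_sub_div hm0ne, one_sub_div hm2ne, div_mul_eq_mul_div, div_mul_eq_mul_div, div_add_div _ _ hm0ne hm2ne,
      div_eq_iff (mul_ne_zero hm0ne hm2ne)]
    linear_combination hN₁
  have hn2 : (1 - T 4) * X 4 + (1 - T 5) * X 5 = c * (1 - a) * (1 - b) := by
    show (1 - (fm - m₂) / m₀) * x₂₀ + (1 - (fm - m₂) / m₁) * x₂₁ = _
    rw [one_sub_div hm0ne, one_sub_div hm1ne, div_mul_eq_mul_div, div_mul_eq_mul_div, div_add_div _ _ hm0ne hm1ne,
      div_eq_iff (mul_ne_zero hm0ne hm1ne)]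
    linear_combination hN₂
  have he01 : T 0 * X 0 + T 2 * X 2 ≤ a * b * (1 - c) := by
    show (fm - m₀) / m₁ * x₀₁ + (fm - m₁) / m₀ * x₁₀ ≤ _
    rw [div_mul_eq_mul_div, div_mul_eq_mul_div, div_add_div _ _ hm1ne hm0ne, div_le_iff₀ (mul_pos hmp1 hmp0)]
    linear_combination hE₀₁
  have he02 : T 1 * X 1 + T 4 * X 4 ≤ a * c * (1 - b) := by
    show (fm - m₀) / m₂ * x₀₂ + (fm - m₂) / m₀ * x₂₀ ≤ _
    rw [div_mul_eq_mul_div, div_mul_eq_mul_div, div_add_div _ _ hm2ne hm0ne, div_le_iff₀ (mul_pos hmp2 hmp0)]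
    linear_combination hE₀₂
  have he12 : T 3 * X 3 + T 5 * X 5 ≤ b * c * (1 - a) := by
    show (fm - m₁) / m₂ * x₁₂ + (fm - m₂) / m₁ * x₂₁ ≤ _
    rw [div_mul_eq_mul_div, div_mul_eq_mul_div, div_add_div _ _ hm2ne hm1ne, div_le_iff₀ (mul_pos hmp2 hmp1)]
    linear_combination hE₁₂
  clear hN₀ hN₁ hN₂ hE₀₁ hE₀₂ hE₁₂
  -- the certificate data
  set u : Fin 10 → ℝ := ![X 0, X 1, X 2, X 3, X 4, X 5,
      a * b * (1 - c) - T 0 * X 0 - T 2 * X 2, a * c * (1 - b) - T 1 * X 1 - T 4 * X 4, b * c * (1 - a) - T 3 * X 3 - T 5 * X 5,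
      a * b * c] with hu
  set E : Fin 10 → Finset (Fin 3) := ![{0, 1}, {0, 2}, {0, 1}, {1, 2}, {0, 2}, {1, 2}, {0, 1}, {0, 2}, {1, 2}, {0, 1, 2}] with hE
  set o : Fin 10 → Fin 3 → ℝ := ![fun l => if l = (0 : Fin 3) then 1 else if l = (1 : Fin 3) then T 0 else T 1,
      fun l => if l = (0 : Fin 3) then 1 else if l = (1 : Fin 3) then T 0 else T 1,
      fun l => if l = (1 : Fin 3) then 1 else if l = (0 : Fin 3) then T 2 else T 3,
      fun l => if l = (1 : Fin 3) then 1 else if l = (0 : Fin 3) then T 2 else T 3,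
      fun l => if l = (2 : Fin 3) then 1 else if l = (0 : Fin 3) then T 4 else T 5,
      fun l => if l = (2 : Fin 3) then 1 else if l = (0 : Fin 3) then T 4 else T 5,
      fun _ => 1, fun _ => 1, fun _ => 1, fun _ => 1] with ho
  set v : Fin 10 → ℝ := ![x, x, x, x, x, x, x * (m₀ + m₁ + m₂) / fm, x * (m₀ + m₁ + m₂) / fm, x * (m₀ + m₁ + m₂) / fm,
      x * (m₀ + m₁ + m₂) / fm] with hv
  -- component means
  have hmc : ∀ k, fmean (subRegate [s₀, s₁, s₂] (E k) (o k)) = (![fm, fm, fm, fm, fm, fm, m₀ + m₁, m₀ + m₂, m₁ + m₂, m₀ + m₁ + m₂] : Fin 10 → ℝ) k := by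
    intro k
    rw [fmean_subRegate, Finset.sum_congr rfl fun i _ => by rw [hmean i]]
    fin_cases k <;> simp [hE, ho, hTdef, Finset.sum_insert, div_mul_cancel₀ _ hm0ne, div_mul_cancel₀ _ hm1ne, div_mul_cancel₀ _ hm2ne]
    ring
  refine sdec_flaw_of_subproductMix hx0 hx1 [s₀, s₁, s₂] hL (by simp) hO (Finset.univ : Finset (Fin 10)) u E o
    ?_ ?_ ?_ ?_ ?_ v ?_ ?_ ?_ ?_
  · intro k _
    have s6 : 0 ≤ a * b * (1 - c) - T 0 * X 0 - T 2 * X 2 := by linarith only [he01]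
    have s7 : 0 ≤ a * c * (1 - b) - T 1 * X 1 - T 4 * X 4 := by linarith only [he02]
    have s8 : 0 ≤ b * c * (1 - a) - T 3 * X 3 - T 5 * X 5 := by linarith only [he12]
    have s9 : 0 ≤ a * b * c := by positivity
    fin_cases k
    exacts [hx₀₁, hx₀₂, hx₁₀, hx₁₂, hx₂₀, hx₂₁, s6, s7, s8, s9]
  · -- `0 < o`: every openness is `1` or some `T j`
    have hA : ∀ i : Fin 3, (0 : ℝ) < (if i = (0 : Fin 3) then 1 else if i = (1 : Fin 3) then T 0 else T 1) := by
      intro i; split_ifs <;> first | exact one_pos | exact hT0 _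
    have hB : ∀ i : Fin 3, (0 : ℝ) < (if i = (1 : Fin 3) then 1 else if i = (0 : Fin 3) then T 2 else T 3) := by
      intro i; split_ifs <;> first | exact one_pos | exact hT0 _
    have hC : ∀ i : Fin 3, (0 : ℝ) < (if i = (2 : Fin 3) then 1 else if i = (0 : Fin 3) then T 4 else T 5) := by
      intro i; split_ifs <;> first | exact one_pos | exact hT0 _
    intro k _ i _
    fin_cases k <;> first | exact hA i | exact hB i | exact hC i | exact one_pos
  · have hA : ∀ i : Fin 3, (if i = (0 : Fin 3) then 1 else if i = (1 : Fin 3) then T 0 else T 1) ≤ (1 : ℝ) := by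
      intro i; split_ifs <;> first | exact le_rfl | exact hT1 _
    have hB : ∀ i : Fin 3, (if i = (1 : Fin 3) then 1 else if i = (0 : Fin 3) then T 2 else T 3) ≤ (1 : ℝ) := by
      intro i; split_ifs <;> first | exact le_rfl | exact hT1 _
    have hC : ∀ i : Fin 3, (if i = (2 : Fin 3) then 1 else if i = (0 : Fin 3) then T 4 else T 5) ≤ (1 : ℝ) := by
      intro i; split_ifs <;> first | exact le_rfl | exact hT1 _
    intro k _ i _
    fin_cases k <;> first | exact hA i | exact hB i | exact hC i | exact le_rfl
  · intro k _
    have n2a : (2 : Fin 3) ∉ ({0, 1} : Finset (Fin 3)) := by decide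
    have n1 : (1 : Fin 3) ∉ ({0, 2} : Finset (Fin 3)) := by decide
    have n0 : (0 : Fin 3) ∉ ({1, 2} : Finset (Fin 3)) := by decide
    fin_cases k
    · exact ⟨2, Or.inl n2a⟩
    · exact ⟨1, Or.inl n1⟩
    · exact ⟨2, Or.inl n2a⟩
    · exact ⟨0, Or.inl n0⟩
    · exact ⟨1, Or.inl n1⟩
    · exact ⟨0, Or.inl n0⟩
    · exact ⟨2, Or.inl n2a⟩
    · exact ⟨1, Or.inl n1⟩
    · exact ⟨0, Or.inl n0⟩
    · exact ⟨0, Or.inr rfl⟩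
  · intro A hA
    have e : ((∏ i ∈ A, ([s₀, s₁, s₂].get i).q) * ∏ i ∈ Finset.univ \ A, (1 - ([s₀, s₁, s₂].get i).q))
          = (∏ i ∈ A, (![a, b, c] : Fin 3 → ℝ) i) * ∏ i ∈ Finset.univ \ A, (1 - (![a, b, c] : Fin 3 → ℝ) i) := by
      simp only [hgate]
    rw [e, hu, hE, ho]
    exact meanLine_pattern a b c T X hn0 hn1 hn2 A hA
  · intro k _
    have hv' : 0 < x * (m₀ + m₁ + m₂) / fm := by positivity
    fin_cases k <;> simp only [hv] <;> first | exact hx0 | exact hv'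
  · -- floors: `x ≤ 1·y_a`, `x ≤ t_{a,i}·y_i`, `x Σm/fm ≤ y_i` — valid for EVERY sibling, so membership is not needed
    have g01 : x ≤ (fm - m₀) / m₁ * y₁ := by rw [div_mul_eq_mul_div, le_div_iff₀ hmp1]; exact hf01
    have g02 : x ≤ (fm - m₀) / m₂ * y₂ := by rw [div_mul_eq_mul_div, le_div_iff₀ hmp2]; exact hf02
    have g10 : x ≤ (fm - m₁) / m₀ * y₀ := by rw [div_mul_eq_mul_div, le_div_iff₀ hmp0]; exact hf10
    have g12 : x ≤ (fm - m₁) / m₂ * y₂ := by rw [div_mul_eq_mul_div, le_div_iff₀ hmp2]; exact hf12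
    have g20 : x ≤ (fm - m₂) / m₀ * y₀ := by rw [div_mul_eq_mul_div, le_div_iff₀ hmp0]; exact hf20
    have g21 : x ≤ (fm - m₂) / m₁ * y₁ := by rw [div_mul_eq_mul_div, le_div_iff₀ hmp1]; exact hf21
    have ga : x ≤ 1 * y₀ := hxa.trans (mul_le_mul_of_nonneg_right ha1.le hy00.le)
    have gb : x ≤ 1 * y₁ := hxb.trans (mul_le_mul_of_nonneg_right hb1.le hy10.le)
    have gc : x ≤ 1 * y₂ := hxc.trans (mul_le_mul_of_nonneg_right hc1.le hy20.le)
    have F0 : x * (m₀ + m₁ + m₂) / fm ≤ 1 * y₀ := by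
      rw [one_mul, div_le_iff₀ hfm0]; exact hF₀.trans (le_of_eq (mul_comm _ _))
    have F1 : x * (m₀ + m₁ + m₂) / fm ≤ 1 * y₁ := by
      rw [one_mul, div_le_iff₀ hfm0]; exact hF₁.trans (le_of_eq (mul_comm _ _))
    have F2 : x * (m₀ + m₁ + m₂) / fm ≤ 1 * y₂ := by
      rw [one_mul, div_le_iff₀ hfm0]; exact hF₂.trans (le_of_eq (mul_comm _ _))
    have hA : ∀ i : Fin [s₀, s₁, s₂].length,
        x ≤ (if i = (0 : Fin 3) then 1 else if i = (1 : Fin 3) then T 0 else T 1) * ([s₀, s₁, s₂].get i).x₁ := by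
      intro i; fin_cases i
      · exact ga
      · exact g01
      · exact g02
    have hB : ∀ i : Fin [s₀, s₁, s₂].length,
        x ≤ (if i = (1 : Fin 3) then 1 else if i = (0 : Fin 3) then T 2 else T 3) * ([s₀, s₁, s₂].get i).x₁ := by
      intro i; fin_cases i
      · exact g10
      · exact gb
      · exact g12
    have hC : ∀ i : Fin [s₀, s₁, s₂].length,
        x ≤ (if i = (2 : Fin 3) then 1 else if i = (0 : Fin 3) then T 4 else T 5) * ([s₀, s₁, s₂].get i).x₁ := by
      intro i; fin_cases i
      · exact g20
      · exact g21
      · exact gc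
    have hOp : ∀ i : Fin [s₀, s₁, s₂].length, x * (m₀ + m₁ + m₂) / fm ≤ 1 * ([s₀, s₁, s₂].get i).x₁ := by
      intro i; fin_cases i
      · exact F0
      · exact F1
      · exact F2
    intro k _ i _
    fin_cases k <;> first | exact hA i | exact hB i | exact hC i | exact hOp i
  · intro k _
    rw [hmc]
    have q0 : x * fm ≤ fmean [s₀, s₁, s₂] * x := le_of_eq (by rw [hfmdef]; ring)
    have q1 : x * (m₀ + m₁) ≤ fmean [s₀, s₁, s₂] * (x * (m₀ + m₁ + m₂) / fm) := by
      rw [← hfmdef, mul_div_assoc', mul_div_cancel_left₀ _ hfm0.ne']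
      exact mul_le_mul_of_nonneg_left (by linarith only [hmp2]) hx0.le
    have q2 : x * (m₀ + m₂) ≤ fmean [s₀, s₁, s₂] * (x * (m₀ + m₁ + m₂) / fm) := by
      rw [← hfmdef, mul_div_assoc', mul_div_cancel_left₀ _ hfm0.ne']
      exact mul_le_mul_of_nonneg_left (by linarith only [hmp1]) hx0.le
    have q3 : x * (m₁ + m₂) ≤ fmean [s₀, s₁, s₂] * (x * (m₀ + m₁ + m₂) / fm) := by
      rw [← hfmdef, mul_div_assoc', mul_div_cancel_left₀ _ hfm0.ne']
      exact mul_le_mul_of_nonneg_left (by linarith only [hmp0]) hx0.le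
    have q4 : x * (m₀ + m₁ + m₂) ≤ fmean [s₀, s₁, s₂] * (x * (m₀ + m₁ + m₂) / fm) := by
      rw [← hfmdef, mul_div_assoc', mul_div_cancel_left₀ _ hfm0.ne']
    fin_cases k <;> simp only [hv] <;> first | exact q0 | exact q1 | exact q2 | exact q3 | exact q4
  · intro k _
    rw [hmc, ← hfmdef]
    have p0 : fm ≤ fm := le_rfl
    have p4 : fm ≤ m₀ + m₁ + m₂ := by linarith only [hp01, hmp2]
    fin_cases k <;> simp <;> first | exact p0 | exact hp01 | exact hp02 | exact hp12 | exact p4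

end LawDec
end Quant
end Summit.CriticalPhenomena.PercolationContinuityZ3.Theorems
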